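import Literature.AlgebraicGeometry.Motives.AbelianVarietyRosatiStableSubalgebra
import Literature.AlgebraicGeometry.Motives.AbelianVarietyEndAlgebraInstances
import Literature.RingTheory.CentralSimple.PositiveInvolutionStableSubalgebra
import Literature.RingTheory.CentralSimple.AlbertTypesNumberField
import HarnessLib

/-!
# The Rosati involution of an ample divisor as a positive anti-involution of `End⁰(A)` (uniformisation-free), and its
# pull-back to any `ℚ`-algebra mapped injectively onto a subalgebra whose generators have level adjoints
# (Mumford §20 (3), §21 Thm. 1; Lange 2023 §2.4.1; Milne CM Prop. 1.37)

Layer `Literature/AlgebraicGeometry/Motives`, namespace `Literature.AlgebraicGeometry.Motives.AbelianVariety` (one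
pure-algebra lemma in `Literature.RingTheory.CentralSimple`).  THEOREMS ONLY: no definition, no instance, no named fact,
no `sorry` (net Literature debt 0).  Sequel of ★ `Motives/AbelianVarietyRosatiStableSubalgebra` (a level adjoint is the
Rosati dual; a Rosati-stable subalgebra carries a positive anti-involution) and of ★
`RingTheory/CentralSimple/PositiveInvolutionStableSubalgebra` (Milne CM Prop. 1.37: positivity transfers along an injective
algebra homomorphism onto a stable subalgebra).  Everything is over `ℂ`; no Galois action, no descent.

THE PRINT.  D. Mumford, *Abelian Varieties* (1970), §20 p. 186 (3) «`e_n(f(x), ŷ) = e_n(x, f̂(ŷ))`», p. 189 (the Rosati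
involution), §21 Thm. 1 (p. 192: positivity).  H. Lange, *Abelian Varieties over the Complex Numbers* (2023), §2.4.1 Lemma
2.4.1, Prop. 2.4.2 (a), Thm. 2.4.9 (pp. 113–117).  J. S. Milne, *Complex Multiplication* (2006), Ch. I §1 Prop. 1.37 (p. 20)
(a subalgebra stable under a positive involution inherits a positive involution).

WHAT IS PROVED.
* §1 **`exists_isPositiveAntiInvolution_endAlgebra_of_isAmple`** — for a complex abelian variety `A` and an AMPLE divisor
  `Θ`: there is a `ℚ`-linear `σ : End⁰(A) → End⁰(A)` which is a POSITIVE ANTI-INVOLUTION and which is «the» Rosati involution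
  of `Θ` in the only sense the tree's carriers can state without the dual abelian variety: **whenever `x, x† ∈ End(A)` and
  `d ∈ ℕ ∖ 0` satisfy `ē_N^Θ((d·x) P, Q) = ē_N^Θ(P, x† Q)` for all `N, P, Q`, then `σ(1 ⊗ x) = d⁻¹ · (1 ⊗ x†)`**
  (uniformise, ★ `exists_uniformisation_isRiemannForm_of_isAmple`; rational Gram matrix, ★
  `IsRiemannForm.exists_ratMatrix_latticeGram`; `σ := ρ⁻¹ ∘ rosati G ∘ ρ` on `End⁰(A) ≃ End_ℚ(X)`, ★
  `rosati_mem_endAlgRat`; positivity ★ `leftMulTrace_pos_of_adjoint_repr`; the characterisation is ★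
  `endToEndAlgRat_eq_smul_rosati_of_forall_weilPairingLevel`).  NO uniformisation data in the statement.
* §2 `IsAntiInvolution.forall_exists_apply_eq_of_adjoin_eq_top` (pure algebra) — stability of the image of
  `ρ : B →ₐ[ℚ] D` under an anti-involution `σ` of `D` is tested on GENERATORS of `B`.
* §3 **`exists_isPositiveAntiInvolution_of_injective_of_levelAdjoint`** — the `SocketRosH` producer: for an injective
  `ρ : B →ₐ[ℚ] End⁰(A)` (e.g. a Hecke algebra) and generators `g` of `B` with `ρ g = q · (1 ⊗ x)` whose `x` has a level
  adjoint `x†` with `1 ⊗ x† = ρ c`, `c ∈ B`, the algebra `B` carries a positive anti-involution `τ` with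
  `σ (ρ b) = ρ (τ b)` — in particular `τ g = (q d⁻¹) · c` on those generators (§1, §2, ★ Milne CM Prop. 1.37
  `IsPositiveAntiInvolution.exists_of_injective`).

USE (cell `hodgecm-mathlib`, D-0151, crux `HLiu418` = stmt-HodgeConjecture-24832, d6 card S2′ road (P), socket `SocketRosH`
«the Hecke image carries a positive anti-involution», A-plan2 (g12) 2026-08-30T03:53:02Z; director RULING s213 (J-isog):
`A := ⊞_c J(E_c ⊗ ℂ)`, `ρ` = Hecke image → `End⁰(A_K ⊗ ℂ) ≃ End⁰(A)` along the comparison isogeny, level adjoints from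
`Motives/JacobianGaloisCoverNormAdjoint` + ★ `Motives/JacobianGaloisCoverNorm` + ★ `Liu2021/AppendixC/HeckeEndomorphismPushPull`).
The file moves no book (HC_CM is proved only modulo the 7 printed citations until rung 0 closes).

## References
* [MumfordAV1970] D. Mumford, *Abelian Varieties* (1970), §20 (p. 186, property (3) of `e_n`; p. 189), §21 Thm. 1 (p. 192).
* [Lange2023AbelianVarietiesComplex] H. Lange, *Abelian Varieties over the Complex Numbers* (2023), §2.4.1 Lemma 2.4.1,
  Prop. 2.4.2, Thm. 2.4.9 (pp. 113–117).
* [MilneCM2006] J. S. Milne, *Complex Multiplication* (2006), Ch. I §1 Prop. 1.37 (p. 20).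
-/

noncomputable section

open CategoryTheory AlgebraicGeometry Complex
open scoped Matrix
open Literature.Geometry.Kaehler Literature.Geometry.Kaehler.ComplexTorus
open Literature.NumberTheory.Transcendental Literature.AlgebraicGeometry.HodgeTheory
open Literature.RingTheory.CentralSimple Literature.NumberTheory.Automorphic Literature.AlgebraicGeometry.ComplexMultiplication

/-! ### §2 (pure algebra) Stability under an anti-involution is tested on generators -/

namespace Literature.RingTheory.CentralSimple

/-- **Stability of the image of an algebra homomorphism under an anti-involution is tested on generators**: if `σ` is an
anti-involution of the `ℚ`-algebra `D`, `ρ : B → D` an algebra homomorphism and `B = ℚ[G]`, and `σ(ρ g) ∈ ρ(B)` for every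
`g ∈ G`, then `σ(ρ b) ∈ ρ(B)` for every `b ∈ B` (`σ` is `ℚ`-linear, reverses products and fixes `1`).
[cite: MilneCM2006, Ch. I §1 Prop. 1.37 (p. 20)] [cite: Lange2023AbelianVarietiesComplex, §2.4.1 Lemma 2.4.1 (p. 113)] -/
theorem IsAntiInvolution.forall_exists_apply_eq_of_adjoin_eq_top {D B : Type*} [Ring D] [Algebra ℚ D] [Ring B] [Algebra ℚ B]
    {σ : D →ₗ[ℚ] D} (hσ : IsAntiInvolution D σ) (ρ : B →ₐ[ℚ] D) {G : Set B} (hgen : Algebra.adjoin ℚ G = ⊤)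
    (hG : ∀ g ∈ G, ∃ c : B, σ (ρ g) = ρ c) : ∀ b : B, ∃ c : B, σ (ρ b) = ρ c := by
  have key : ∀ b ∈ Algebra.adjoin ℚ G, ∃ c : B, σ (ρ b) = ρ c := by
    intro b hb
    induction hb using Algebra.adjoin_induction with
    | mem g hg => exact hG g hg
    | algebraMap r =>
      refine ⟨algebraMap ℚ B r, ?_⟩
      rw [AlgHom.commutes, Algebra.algebraMap_eq_smul_one, _root_.map_smul, hσ.map_one]
    | add x y _ _ ihx ihy =>
      obtain ⟨cx, hx⟩ := ihx
      obtain ⟨cy, hy⟩ := ihy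
      exact ⟨cx + cy, by rw [_root_.map_add ρ, _root_.map_add σ, hx, hy, _root_.map_add ρ]⟩
    | mul x y _ _ ihx ihy =>
      obtain ⟨cx, hx⟩ := ihx
      obtain ⟨cy, hy⟩ := ihy
      exact ⟨cy * cx, by rw [_root_.map_mul ρ, hσ.map_mul, hx, hy, _root_.map_mul ρ]⟩
  intro b
  exact key b (hgen ▸ Algebra.mem_top)

end Literature.RingTheory.CentralSimple

namespace Literature.AlgebraicGeometry.Motives.AbelianVariety

/-! ### §1 The Rosati involution of an ample divisor: a positive anti-involution of `End⁰(A)`, pinned by level adjoints -/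

section Rosati

/-- **The Rosati involution of an ample divisor is a positive anti-involution of `End⁰(A)`** (Mumford §21 Thm. 1; Lange Thm.
2.4.9), uniformisation-free and pinned on the tree's carriers by LEVEL ADJOINTS: for a complex abelian variety `A` and an ample
`Θ` there is a `ℚ`-linear `σ : End⁰(A) → End⁰(A)` with `σ(yz) = σ(z)σ(y)`, `σ(σ y) = y`, `Tr_{End⁰(A)/ℚ}(L_{σ(y)·y}) > 0` for
`y ≠ 0`, such that `σ(1 ⊗ x) = d⁻¹ · (1 ⊗ x†)` whenever `ē_N^Θ((d·x) P, Q) = ē_N^Θ(P, x† Q)` for all levels `N` and all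
`P, Q ∈ A[N](ℂ)` (`d ∈ ℕ ∖ 0`; Mumford §20 (3) «`e_n(f(x), ŷ) = e_n(x, f̂(ŷ))`»).  Construction: `σ := ρ⁻¹ ∘ rosati G ∘ ρ`
for a uniformisation and the rational Gram matrix `G` of the Riemann form of `Θ`; the pinning is ★
`endToEndAlgRat_eq_smul_rosati_of_forall_weilPairingLevel`. [cite: MumfordAV1970, §20 (p. 186, property (3) of e_n; p. 189) and §21 Thm. 1 (p. 192)]
[cite: Lange2023AbelianVarietiesComplex, §2.4.1 Lemma 2.4.1 and Theorem 2.4.9 (pp. 113–117)] -/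
theorem exists_isPositiveAntiInvolution_endAlgebra_of_isAmple (A : AbelianVariety ℂ) {Θ : CartierDivisor A.X.left}
    (hΘ : Θ.IsAmple) :
    ∃ σ : A.endAlgebra →ₗ[ℚ] A.endAlgebra, IsPositiveAntiInvolution A.endAlgebra σ ∧
      ∀ (x xd : End A) (d : ℕ), d ≠ 0 →
        (∀ (N : ℕ) [IsDominant (Hom.toSchemeHom ((N : ℤ) • 𝟙 A))] (P Q : A.torsionPoints ℂ N),
          A.weilPairingLevel Θ ⟨AlgPoints.map ((d : ℤ) • x).hom.hom.hom P.1, map_mem_torsionPoints ((d : ℤ) • x) P.2⟩ Q =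
            A.weilPairingLevel Θ P ⟨AlgPoints.map xd.hom.hom.hom Q.1, map_mem_torsionPoints xd Q.2⟩) →
        σ (endAlgebra.of A x) = (d : ℚ)⁻¹ • endAlgebra.of A xd := by
  classical
  -- uniformise `A` with the Riemann form of `Θ` and a rational Gram matrix
  obtain ⟨ι, _, _, Φ, φ, hφ, hadd, p, hp, hR⟩ := A.exists_uniformisation_isRiemannForm_of_isAmple hΘ
  obtain ⟨G, hG⟩ := hR.exists_ratMatrix_latticeGram
  set e := endAlgebraEquivOfAnalytification hφ hadd with he
  -- the rational representation `ψ : End⁰(A) → M_ι(ℚ)`, injective with image `End_ℚ(X)`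
  let ψ : A.endAlgebra →ₐ[ℚ] Matrix ι ι ℚ := (endAlgRat Φ).val.comp e.toAlgHom
  have hψ : ∀ y, ψ y = ((e y : endAlgRat Φ) : Matrix ι ι ℚ) := fun _ => rfl
  have hψmem : ∀ y, ψ y ∈ endAlgRat Φ := fun y => (e y).2
  have hψinj : Function.Injective ψ := Subtype.val_injective.comp e.injective
  have hGu : IsUnit G.det := isUnit_det_of_map_ratCast hG (isUnit_det_latticeGram Φ hR.1 hR.2.2)
  have hGt : G.transpose = -G := transpose_eq_neg_of_map_ratCast Φ hG
  -- `σ := ρ⁻¹ ∘ rosati G ∘ ρ`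
  let σ₁ : A.endAlgebra → A.endAlgebra := fun y =>
    e.symm ⟨rosati G (ψ y), rosati_mem_endAlgRat Φ hR.1 hR.2.2 hG (hψmem y)⟩
  have hσ₁ : ∀ y, ψ (σ₁ y) = rosati G (ψ y) := fun y => by
    change (((e (e.symm _)) : endAlgRat Φ) : Matrix ι ι ℚ) = _
    rw [AlgEquiv.apply_symm_apply]
  have hadd' : ∀ y z, σ₁ (y + z) = σ₁ y + σ₁ z := fun y z =>
    hψinj (by rw [hσ₁, map_add, rosati_add, map_add, hσ₁, hσ₁])
  have hsmul' : ∀ (c : ℚ) y, σ₁ (c • y) = c • σ₁ y := fun c y =>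
    hψinj (by rw [hσ₁, map_smul, rosati_smul, map_smul, hσ₁])
  let σ : A.endAlgebra →ₗ[ℚ] A.endAlgebra := { toFun := σ₁, map_add' := hadd', map_smul' := hsmul' }
  have hσ : ∀ y, ψ (σ y) = rosati G (ψ y) := hσ₁
  refine ⟨σ, ⟨⟨fun y z => hψinj ?_, fun y => hψinj ?_⟩, fun y hy => ?_⟩, fun x xd d hd h => ?_⟩
  · rw [hσ, map_mul, rosati_mul hGu, map_mul, hσ, hσ]
  · rw [hσ, hσ, rosati_rosati hGu hGt]
  · -- positivity, through the real symmetric form `S = ᵗJ G_ℝ`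
    haveI : Module.Finite ℚ A.endAlgebra := Module.Finite.of_injective ψ.toLinearMap hψinj
    rw [leftMulTrace_apply]
    have hS : ((jMatrix Φ).transpose * latticeGram Φ p.form).PosDef :=
      posDef_transpose_jMatrix_mul_latticeGram Φ hR.1 hR.2.2
    refine leftMulTrace_pos_of_adjoint_repr ψ hψinj hS σ (fun z => ?_) hy
    have hz : (ψ z).map (Rat.cast : ℚ → ℝ) * jMatrix Φ = jMatrix Φ * (ψ z).map (Rat.cast : ℚ → ℝ) :=
      (mem_endAlgRat_iff Φ _).1 (hψmem z)
    rw [hσ, show (rosati G (ψ z)).map (Rat.cast : ℚ → ℝ) = (rosati G (ψ z)).map (Rat.castHom ℝ) from rfl,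
      rosati_map (Rat.castHom ℝ) hGu, Rat.coe_castHom, hG, rosati_eq_symmAdjoint Φ _ hz]
  · -- the pinning by level adjoints
    have hmat := endToEndAlgRat_eq_smul_rosati_of_forall_weilPairingLevel hφ hadd Θ hΘ p hp hR hG h
    apply hψinj
    rw [hσ, map_smul, hψ, hψ, endAlgebraEquivOfAnalytification_of, endAlgebraEquivOfAnalytification_of, hmat,
      ← Int.cast_smul_eq_zsmul ℚ (d : ℤ), smul_smul, Int.cast_natCast, inv_mul_cancel₀ (Nat.cast_ne_zero.2 hd), one_smul]

end Rosati

/-! ### §3 Pull-back to an injective `ρ : B →ₐ[ℚ] End⁰(A)` whose generators have level adjoints (the `SocketRosH` producer) -/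

section Producer

/-- **A `ℚ`-algebra mapped injectively into `End⁰(A)` onto a subalgebra whose generators have LEVEL ADJOINTS carries a positive
anti-involution** (Milne CM Prop. 1.37 for the Rosati involution of §1): let `A` be a complex abelian variety, `Θ` ample,
`ρ : B →ₐ[ℚ] End⁰(A)` injective, `B = ℚ[G]`, and suppose every `g ∈ G` has `ρ g = q · (1 ⊗ x)` with `x ∈ End(A)` admitting a
level adjoint `x†` (`ē_N^Θ((d·x) P, Q) = ē_N^Θ(P, x† Q)`, `d ∈ ℕ ∖ 0`) such that `1 ⊗ x† = ρ c` for some `c ∈ B`.  Then there is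
a `ℚ`-linear `τ : B → B` which is a POSITIVE ANTI-INVOLUTION of `B`, intertwined with the Rosati involution `σ` of §1
(`σ (ρ b) = ρ (τ b)`), and `τ g = (q·d⁻¹) · c` on those generators. (The Hecke algebra of a Shimura curve acting on its
Albanese variety: `g = [KgK] = (card)⁻¹ · (1 ⊗ (t ≫ Σ translates))`, level adjoints from the norm/pull-back adjointness of
Galois covers.) [cite: MilneCM2006, Ch. I §1 Prop. 1.37 (p. 20)] [cite: MumfordAV1970, §20 (p. 186, property (3) of e_n) and §21 Thm. 1 (p. 192)]
[cite: Lange2023AbelianVarietiesComplex, §2.4.1 Theorem 2.4.9 (pp. 116–117)] -/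
theorem exists_isPositiveAntiInvolution_of_injective_of_levelAdjoint (A : AbelianVariety ℂ) {Θ : CartierDivisor A.X.left}
    (hΘ : Θ.IsAmple) {B : Type} [Ring B] [Algebra ℚ B] (ρ : B →ₐ[ℚ] A.endAlgebra) (hρ : Function.Injective ρ)
    {G : Set B} (hgen : Algebra.adjoin ℚ G = ⊤)
    (hG : ∀ g ∈ G, ∃ (q : ℚ) (x xd : End A) (d : ℕ) (c : B), ρ g = q • endAlgebra.of A x ∧ d ≠ 0 ∧
      ρ c = endAlgebra.of A xd ∧
      ∀ (N : ℕ) [IsDominant (Hom.toSchemeHom ((N : ℤ) • 𝟙 A))] (P Q : A.torsionPoints ℂ N),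
        A.weilPairingLevel Θ ⟨AlgPoints.map ((d : ℤ) • x).hom.hom.hom P.1, map_mem_torsionPoints ((d : ℤ) • x) P.2⟩ Q =
          A.weilPairingLevel Θ P ⟨AlgPoints.map xd.hom.hom.hom Q.1, map_mem_torsionPoints xd Q.2⟩) :
    ∃ (σ : A.endAlgebra →ₗ[ℚ] A.endAlgebra) (τ : B →ₗ[ℚ] B),
      IsPositiveAntiInvolution A.endAlgebra σ ∧ IsPositiveAntiInvolution B τ ∧ (∀ b, σ (ρ b) = ρ (τ b)) ∧
      ∀ (g : B) (q : ℚ) (x xd : End A) (d : ℕ) (c : B), ρ g = q • endAlgebra.of A x → d ≠ 0 →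
        ρ c = endAlgebra.of A xd →
        (∀ (N : ℕ) [IsDominant (Hom.toSchemeHom ((N : ℤ) • 𝟙 A))] (P Q : A.torsionPoints ℂ N),
          A.weilPairingLevel Θ ⟨AlgPoints.map ((d : ℤ) • x).hom.hom.hom P.1, map_mem_torsionPoints ((d : ℤ) • x) P.2⟩ Q =
            A.weilPairingLevel Θ P ⟨AlgPoints.map xd.hom.hom.hom Q.1, map_mem_torsionPoints xd Q.2⟩) →
        τ g = (q * (d : ℚ)⁻¹) • c := by
  obtain ⟨σ, hσ, hpin⟩ := A.exists_isPositiveAntiInvolution_endAlgebra_of_isAmple hΘ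
  -- `σ(ρ g) = ρ((q d⁻¹) · c)` on the generators
  have hval : ∀ (g : B) (q : ℚ) (x xd : End A) (d : ℕ) (c : B), ρ g = q • endAlgebra.of A x → d ≠ 0 →
      ρ c = endAlgebra.of A xd →
      (∀ (N : ℕ) [IsDominant (Hom.toSchemeHom ((N : ℤ) • 𝟙 A))] (P Q : A.torsionPoints ℂ N),
        A.weilPairingLevel Θ ⟨AlgPoints.map ((d : ℤ) • x).hom.hom.hom P.1, map_mem_torsionPoints ((d : ℤ) • x) P.2⟩ Q =
          A.weilPairingLevel Θ P ⟨AlgPoints.map xd.hom.hom.hom Q.1, map_mem_torsionPoints xd Q.2⟩) →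
      σ (ρ g) = ρ ((q * (d : ℚ)⁻¹) • c) := by
    intro g q x xd d c hg hd hc h
    rw [hg, map_smul, hpin x xd d hd h, map_smul, hc, smul_smul]
  have hst : ∀ b, ∃ c, σ (ρ b) = ρ c := by
    refine hσ.toIsAntiInvolution.forall_exists_apply_eq_of_adjoin_eq_top ρ hgen fun g hg => ?_
    obtain ⟨q, x, xd, d, c, hgq, hd, hc, h⟩ := hG g hg
    exact ⟨(q * (d : ℚ)⁻¹) • c, hval g q x xd d c hgq hd hc h⟩
  obtain ⟨τ, hτ, hστ⟩ := hσ.exists_of_injective ρ hρ hst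
  refine ⟨σ, τ, hσ, hτ, hστ, fun g q x xd d c hg hd hc h => hρ ?_⟩
  rw [← hστ, hval g q x xd d c hg hd hc h, map_smul]

/-- **`SocketRosH` shape** (existence only): under the hypotheses of
`exists_isPositiveAntiInvolution_of_injective_of_levelAdjoint`, `B` carries a positive anti-involution.
[cite: MilneCM2006, Ch. I §1 Prop. 1.37 (p. 20)] [cite: MumfordAV1970, §21 Thm. 1 (p. 192)] -/
theorem exists_isPositiveAntiInvolution_of_injective_of_levelAdjoint' (A : AbelianVariety ℂ) {Θ : CartierDivisor A.X.left}
    (hΘ : Θ.IsAmple) {B : Type} [Ring B] [Algebra ℚ B] (ρ : B →ₐ[ℚ] A.endAlgebra) (hρ : Function.Injective ρ)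
    {G : Set B} (hgen : Algebra.adjoin ℚ G = ⊤)
    (hG : ∀ g ∈ G, ∃ (q : ℚ) (x xd : End A) (d : ℕ) (c : B), ρ g = q • endAlgebra.of A x ∧ d ≠ 0 ∧
      ρ c = endAlgebra.of A xd ∧
      ∀ (N : ℕ) [IsDominant (Hom.toSchemeHom ((N : ℤ) • 𝟙 A))] (P Q : A.torsionPoints ℂ N),
        A.weilPairingLevel Θ ⟨AlgPoints.map ((d : ℤ) • x).hom.hom.hom P.1, map_mem_torsionPoints ((d : ℤ) • x) P.2⟩ Q =
          A.weilPairingLevel Θ P ⟨AlgPoints.map xd.hom.hom.hom Q.1, map_mem_torsionPoints xd Q.2⟩) :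
    ∃ τ : B →ₗ[ℚ] B, IsPositiveAntiInvolution B τ := by
  obtain ⟨-, τ, -, hτ, -, -⟩ := A.exists_isPositiveAntiInvolution_of_injective_of_levelAdjoint hΘ ρ hρ hgen hG
  exact ⟨τ, hτ⟩

end Producer

end Literature.AlgebraicGeometry.Motives.AbelianVariety

end
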